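import Literature.NumberTheory.Automorphic.SmoothRepresentation
import Literature.RepresentationTheory.Semisimple.UnitaryLocallyFinite
import Mathlib.Topology.LocallyConstant.Basic
import HarnessLib

/-!
# Smooth representations of COMPACT groups are locally finite; with an invariant inner product they are semisimple and
# the isotypic components exhaust the space (piece (α) of the compact-doubling plan for `rankOne_theta_lines_disjoint`)

Topic `RepresentationTheory/Semisimple`; theorems only (no definition, no named fact).  Companion of `UnitaryLocallyFinite`
(Knapp–Vogan IX §1: unitary + locally finite ⇒ semisimple, isotypic components span) and of
`Literature/NumberTheory/Automorphic/SmoothRepresentation` (`Representation.IsSmooth`: every vector has OPEN stabiliser,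
[BernsteinZelevinsky1976, §2.1]).

* `isLocallyConstant_apply_of_isSmoothVector` — for a smooth vector `v` the orbit map `g ↦ ρ g v` is locally constant (constant
  on the open cosets `g₀ · Stab(v)`); hence, for `G` COMPACT, the orbit is FINITE (`finite_range_apply_of_isSmoothVector`, Mathlib
  `IsLocallyConstant.range_finite`) and spans a finite-dimensional subspace (`finiteDimensional_span_orbit_of_isSmoothVector`):
  a smooth representation of a compact (e.g. profinite) group is LOCALLY FINITE — [Bump1997, Prop. 4.2.5] / [BernsteinZelevinsky1976,
  §2.1] (a smooth vector of a compact totally disconnected group generates a finite-dimensional subrepresentation).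
* `isSemisimpleModule_asModule_of_isSmooth` / `isSemisimpleRepresentation_of_isSmooth` — with an invariant inner product
  (unitary operators) a smooth representation of a compact group on a complex inner product space is semisimple
  (`UnitaryLocallyFinite.isSemisimpleModule_asModule` fed with the local finiteness above);
* `iSup_toSubspace_isotypicComponents_eq_top_of_isSmooth` — its isotypic components span the space, so a linear map that
  vanishes on every isotypic component vanishes (`eq_zero_of_forall_isotypicComponents`);
* `mem_toSubspace_isotypicComponent_of_commute` — an operator commuting with the group preserves every isotypic component
  (Mathlib `Submodule.IsFullyInvariant.of_mem_isotypicComponents` for the induced `ℂ[G]`-linear endomorphism).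

Consumer (cell hodgecm-mathlib, row IV-4(c1), «compact (anisotropic) doubling» plan of record): the smooth Weil representation of
the doubled pair restricted to the COMPACT unitary group `U(𝕎₂)(F_v)` of an anisotropic skew-hermitian plane (profinite, acting
unitarily on `𝒮 ⊂ L²`) is the algebraic sum of its isotypic components, each stable under the commuting `U(V)(F_v)`; a
`U(V)`-eigenfunctional vanishing on every isotypic component vanishes.  Nothing about Weil representations is in this file.

## References
* [BernsteinZelevinsky1976] I. N. Bernstein, A. V. Zelevinsky, Russian Math. Surveys 31:3 (1976), §2.1 (smooth vectors,
  compact open subgroups act through finite quotients).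
* [Bump1997] D. Bump, *Automorphic Forms and Representations*, CUP 1997, Prop. 4.2.5 and §4.2 p. 423.
* Knapp–Vogan 1995, Ch. IX §1 / Ch. I §4 (via the tree's `UnitaryLocallyFinite`).
-/

noncomputable section

open scoped InnerProductSpace MonoidAlgebra

namespace Literature.RepresentationTheory.Semisimple

/-! ## Smooth vectors of compact groups have finite orbits -/

section Orbit

variable {k : Type*} [CommRing k] {G : Type*} [Group G] [TopologicalSpace G] [IsTopologicalGroup G]
  {V : Type*} [AddCommGroup V] [Module k V] (ρ : Representation k G V)

/-- The orbit map `g ↦ ρ g v` of a SMOOTH vector (open stabiliser) is locally constant: it is constant on each open coset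
`g₀ · Stab(v)`. [cite: BernsteinZelevinsky1976, §2.1] -/
theorem isLocallyConstant_apply_of_isSmoothVector {v : V} (hv : ρ.IsSmoothVector v) :
    IsLocallyConstant fun g : G => ρ g v := by
  refine (IsLocallyConstant.iff_eventually_eq _).2 fun g₀ => ?_
  have hopen : IsOpen ((Homeomorph.mulLeft g₀) '' (ρ.stabilizerSubgroup v : Set G)) :=
    (Homeomorph.mulLeft g₀).isOpenMap _ hv
  have hmem : g₀ ∈ (Homeomorph.mulLeft g₀) '' (ρ.stabilizerSubgroup v : Set G) :=
    ⟨1, (ρ.stabilizerSubgroup v).one_mem, by simp⟩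
  refine Filter.eventually_of_mem (hopen.mem_nhds hmem) ?_
  rintro _ ⟨s, hs, rfl⟩
  rw [Homeomorph.coe_mulLeft, map_mul, Module.End.mul_apply, (ρ.mem_stabilizerSubgroup v s).1 hs]

/-- **A smooth vector of a COMPACT group has a finite orbit** (locally constant maps on compact spaces have finite range).
[cite: BernsteinZelevinsky1976, §2.1] -/
theorem finite_range_apply_of_isSmoothVector [CompactSpace G] {v : V} (hv : ρ.IsSmoothVector v) :
    (Set.range fun g : G => ρ g v).Finite :=
  (isLocallyConstant_apply_of_isSmoothVector ρ hv).range_finite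

end Orbit

section Span

variable {k : Type*} [Field k] {G : Type*} [Group G] [TopologicalSpace G] [IsTopologicalGroup G] [CompactSpace G]
  {V : Type*} [AddCommGroup V] [Module k V] (ρ : Representation k G V)

/-- **Smooth representations of compact groups are locally finite**: the orbit of a smooth vector spans a finite-dimensional
subspace ([Bump1997, Prop. 4.2.5]: a smooth vector of a compact totally disconnected group lies in a finite-dimensional invariant
subspace). [cite: Bump1997, Proposition 4.2.5] -/
theorem finiteDimensional_span_orbit_of_isSmoothVector {v : V} (hv : ρ.IsSmoothVector v) :
    FiniteDimensional k (Submodule.span k (Set.range fun g : G => ρ g v)) :=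
  FiniteDimensional.span_of_finite k (finite_range_apply_of_isSmoothVector ρ hv)

/-- The same for every vector of a SMOOTH representation (the hypothesis `hfin` of `UnitaryLocallyFinite`).
[cite: Bump1997, Proposition 4.2.5] -/
theorem finiteDimensional_span_orbit_of_isSmooth (hs : ρ.IsSmooth) (v : V) :
    FiniteDimensional k (Submodule.span k (Set.range fun g : G => ρ g v)) :=
  finiteDimensional_span_orbit_of_isSmoothVector ρ (hs v)

end Span

/-! ## Smooth unitary representations of compact groups: semisimple, isotypic components exhaust -/

section Unitary

variable {G : Type*} [Group G] [TopologicalSpace G] [IsTopologicalGroup G] [CompactSpace G]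
  {V : Type*} [NormedAddCommGroup V] [InnerProductSpace ℂ V] {ρ : Representation ℂ G V}

/-- **A smooth representation of a compact group by unitary operators on a complex inner product space is semisimple** as a
`ℂ[G]`-module (Knapp–Vogan IX §1 via `UnitaryLocallyFinite.isSemisimpleModule_asModule`, local finiteness from smoothness and
compactness). [cite: Bump1997, Proposition 4.2.5] -/
theorem isSemisimpleModule_asModule_of_isSmooth (hU : ∀ g v w, ⟪ρ g v, ρ g w⟫_ℂ = ⟪v, w⟫_ℂ) (hs : ρ.IsSmooth) :
    IsSemisimpleModule ℂ[G] ρ.asModule :=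
  isSemisimpleModule_asModule hU (finiteDimensional_span_orbit_of_isSmooth ρ hs)

/-- The same in Mathlib's representation currency (`Representation.IsSemisimpleRepresentation`).
[cite: Bump1997, Proposition 4.2.5] -/
theorem isSemisimpleRepresentation_of_isSmooth (hU : ∀ g v w, ⟪ρ g v, ρ g w⟫_ℂ = ⟪v, w⟫_ℂ) (hs : ρ.IsSmooth) :
    ρ.IsSemisimpleRepresentation :=
  isSemisimpleRepresentation hU (finiteDimensional_span_orbit_of_isSmooth ρ hs)

/-- **The isotypic components of a smooth unitary representation of a compact group span the space** (their underlying
`ℂ`-subspaces have supremum `⊤`; Mathlib `sSup_isotypicComponents` for the semisimple `ℂ[G]`-module, read through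
`UnitaryLocallyFinite.toSubspace`). [cite: Bump1997, Proposition 4.2.5] -/
theorem iSup_toSubspace_isotypicComponents_eq_top_of_isSmooth (hU : ∀ g v w, ⟪ρ g v, ρ g w⟫_ℂ = ⟪v, w⟫_ℂ)
    (hs : ρ.IsSmooth) : ⨆ c ∈ isotypicComponents ℂ[G] ρ.asModule, toSubspace ρ c = ⊤ :=
  iSup_toSubspace_isotypicComponents_eq_top hU (finiteDimensional_span_orbit_of_isSmooth ρ hs)

/-- **A linear map vanishing on every isotypic component vanishes** (smooth unitary representation of a compact group): the
isotypic components span. [cite: Bump1997, Proposition 4.2.5] -/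
theorem eq_zero_of_forall_isotypicComponents {W : Type*} [AddCommGroup W] [Module ℂ W]
    (hU : ∀ g v w, ⟪ρ g v, ρ g w⟫_ℂ = ⟪v, w⟫_ℂ) (hs : ρ.IsSmooth) (Λ : V →ₗ[ℂ] W)
    (h : ∀ c ∈ isotypicComponents ℂ[G] ρ.asModule, ∀ v ∈ toSubspace ρ c, Λ v = 0) : Λ = 0 := by
  have htop := iSup_toSubspace_isotypicComponents_eq_top_of_isSmooth hU hs
  apply LinearMap.ext
  intro v
  have hv : v ∈ ⨆ c ∈ isotypicComponents ℂ[G] ρ.asModule, toSubspace ρ c := by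
    rw [htop]
    exact Submodule.mem_top
  rw [LinearMap.zero_apply]
  refine Submodule.iSup_induction (p := fun c => ⨆ (_ : c ∈ isotypicComponents ℂ[G] ρ.asModule), toSubspace ρ c)
    (motive := fun x => Λ x = 0) hv (fun c x hx => ?_) (map_zero Λ) (fun x y hx hy => by rw [map_add, hx, hy, add_zero])
  by_cases hc : c ∈ isotypicComponents ℂ[G] ρ.asModule
  · rw [iSup_pos hc] at hx
    exact h c hc x hx
  · rw [iSup_neg hc] at hx
    rw [(Submodule.mem_bot ℂ).1 hx, map_zero]

end Unitary

/-! ## Operators commuting with the group preserve the isotypic components -/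

section Commute

variable {G : Type*} [Group G] {V : Type*} [AddCommGroup V] [Module ℂ V] {ρ : Representation ℂ G V}

/-- An operator `T` on `V` commuting with every `ρ g` is `ℂ[G]`-linear on `ρ.asModule`; read back on `V` it maps each
`ℂ[G]`-submodule's underlying subspace into the underlying subspace of its image, and in particular — isotypic components being
FULLY INVARIANT (Mathlib `Submodule.IsFullyInvariant.of_mem_isotypicComponents`) — **preserves every isotypic component**.
(Bourbaki, Algèbre VIII § 4 n° 6 Prop. 5 a): «`f` induit un homomorphisme `f_λ` de `M_λ` dans `N_λ`».) [cite: BourbakiAlgebreVIII2012, VIII §4 n°6 Prop. 5 a)] -/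
theorem mem_toSubspace_isotypicComponent_of_commute (T : V →ₗ[ℂ] V) (hT : ∀ g : G, T ∘ₗ ρ g = ρ g ∘ₗ T)
    {c : Submodule ℂ[G] ρ.asModule} (hc : c ∈ isotypicComponents ℂ[G] ρ.asModule) {v : V} (hv : v ∈ toSubspace ρ c) :
    T v ∈ toSubspace ρ c := by
  -- `T` read on `ρ.asModule` is `ℂ[G]`-linear (Mathlib: intertwining maps = `ℂ[G]`-linear maps of `asModule`s)
  let I : ρ.IntertwiningMap ρ :=
    LinearMap.intertwiningMap_of_isIntertwiningMap ρ ρ T fun g w => LinearMap.congr_fun (hT g) w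
  let T' : ρ.asModule →ₗ[ℂ[G]] ρ.asModule := Representation.IntertwiningMap.equivLinearMapAsModule ρ ρ I
  have hT' : ∀ x : ρ.asModule, T' x = ρ.asModuleEquiv.symm (T (ρ.asModuleEquiv x)) := fun _ => rfl
  have hinv : c ≤ c.comap T' := Submodule.IsFullyInvariant.of_mem_isotypicComponents hc T'
  rw [mem_toSubspace_iff] at hv ⊢
  have := hinv hv
  rw [Submodule.mem_comap, hT', LinearEquiv.apply_symm_apply] at this
  exact this

end Commute

end Literature.RepresentationTheory.Semisimple

end
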